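import Summits.ResolutionOfSingularities.ResolutionOfSingularities.Theorems.HilbertSamuelEliminationSigmaMaxModificationsCorridor3WLadderIsoInsepE2InitialForm
import HarnessLib

/-!
# [OURS · L1 W4.2] E2 chart calculus, brick 13: (N3b) AT RING LEVEL — «ē = 3 AT THE NEXT POINT ⇒ THE CONE COEFFICIENT `G` IS
# `≡ γ·t (mod 𝔪²)`»: for a hypersurface presentation `σ′ : D ↠ 𝒪` with `ker σ′ = (h′)`, `h′ = ĉ(u² + λ̂v²) + t·G` of order two, residue
# characteristic two and `ē(𝒪) = dim D − 1`, one has `G ∈ (t) + 𝔪_D²` whenever `t ∉ 𝔪_D²` (crux chain w42, cell k2 `T3insep` =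
# `stub_isoInsepTower`; `--supports stmt-ResolutionOfSingularities-19249`)

OURS (cell res-hironaka, slot W4.2, seat res-D-pv-042; OWN OBJECT TUO 18:19Z, (N3) continuation); NOT a statement of [Hironaka2017]
nor of [CossartJannsenSaito2020] / [CossartPiltant2008]. AI-drafted, weaker than expert review. PROOF file, def-free, fact-free.

* `coeff_cross_eq_zero_of_geomDirDim` — the pipeline of brick 2 read for `ē` alone: `R` regular local with regular parameters `y`
  (`emb.dim = d`), `σ : R ↠ A`, `ker σ = (h)`, `h ∈ 𝔪² ∖ 𝔪³`, `F` an initial form of `h` of degree `2`, `char κ(A) = 2`,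
  `geomDirDim A + 1 = d` ⇒ every cross coefficient `[YᵢYⱼ]F` (`i ≠ j`) vanishes (LEMMA T `E1Free.exists_tangentConeIdeal_eq_map_span_singleton`,
  `dirDimOver_eq'`, `directrixDim_span_singleton`, brick 1 `coeff_add_single_eq_zero_of_hironakaTau_le_one`).
* `pderiv_sum_C_mul_X`, `coeff_single_sum_C_mul_X`, `coeff_cross_shape` — the cross coefficients of the E2 successor shape
  `c·((Σ uₖYₖ)² + λ(Σ vₖYₖ)²) + (Σ tₖYₖ)(Σ aₖYₖ)` in characteristic two are `tᵢaⱼ + tⱼaᵢ`.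
* `exists_eq_mul_of_cross_eq_zero` — vectors `t, a` over a field of characteristic two with `tᵢaⱼ + tⱼaᵢ = 0` (`i ≠ j`) and `t ≠ 0`
  are proportional: `a = γ·t`.
* `mem_span_sup_sq_of_geomDirDim` — **(N3b)**: with `h = ĉ(u² + λ̂v²) + t·G`, `u, v, G ∈ 𝔪`, `t ∈ 𝔪 ∖ 𝔪²`, `ē(A) + 1 = d` and residue
  characteristic two: `G ∈ (t) + 𝔪²`.
-/

noncomputable section

set_option linter.dupNamespace false

open scoped Classical
open IsLocalRing MvPolynomial Module
open Literature.RingTheory.MvPolynomial Literature.RingTheory.HilbertSamuel Literature.AlgebraicGeometry.Resolution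
open Summit.ResolutionOfSingularities.ResolutionOfSingularities.Theorems.SigmaMaxModificationsCorridor3

namespace Summit.ResolutionOfSingularities.ResolutionOfSingularities.Cruxes.SigmaMaxModifications.IdeasL1C6.E2Chart

universe u

/-! ## §1. `ē = d − 1` kills every cross coefficient of an initial form (characteristic two) -/

/-- **`ē(A) = emb.dim − 1` ⇒ the initial form is cross-free.** `R` regular local with regular parameters `y : Fin d → R`, `σ : R ↠ A` with
`ker σ = (h)`, `h ∈ 𝔪² ∖ 𝔪³`, `F` an initial form of `h` of degree `2`, residue characteristic two. If `geomDirDim A + 1 = d` then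
`[YᵢYⱼ]F = 0` for all `i ≠ j`: over `κ̄` the tangent cone is `(F̄)` with `τ(F̄) = d − ē = 1`, and `τ ≤ 1` kills cross terms in
characteristic two (brick 1). [OURS · L1 W4.2 · k2 · E2 chart calculus, brick 13] [folklore] -/
theorem coeff_cross_eq_zero_of_geomDirDim {R A : Type u} [CommRing R] [IsRegularLocalRing R] [CommRing A] [IsLocalRing A]
    [IsNoetherianRing A] [CharP (ResidueField A) 2] {d : ℕ} (hd : (maximalIdeal R).spanFinrank = d) (y : Fin d → R)
    (hy : Ideal.span (Set.range y) = maximalIdeal R) (σ : R →+* A) (hσ : Function.Surjective σ) {h : R}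
    (hker : RingHom.ker σ = Ideal.span {h}) (h2 : h ∈ maximalIdeal R ^ 2) (h3 : h ∉ maximalIdeal R ^ (2 + 1))
    {F : MvPolynomial (Fin d) (ResidueField R)} (hF : F ∈ initialFormsOf y h 2) (hgeom : geomDirDim A + 1 = d)
    {i j : Fin d} (hij : i ≠ j) : coeff (Finsupp.single i 1 + Finsupp.single j 1) F = 0 := by
  have hσy : Ideal.span (Set.range (σ ∘ y)) = maximalIdeal A := E1Free.span_range_comp_eq_maximalIdeal hy σ hσ
  obtain ⟨κ, hκ, hJ⟩ := E1Free.exists_tangentConeIdeal_eq_map_span_singleton hd y hy σ hσ hker h2 h3 hF hσy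
  have hd1 : 1 ≤ d := by omega
  have hdA : (maximalIdeal A).spanFinrank = d := E1Free.spanFinrank_maximalIdeal_eq_of_presentation hd σ hσ hker le_rfl h2 h3 hd1
  set G := MvPolynomial.map κ F with hG
  rw [map_span_singleton_mvPolynomial] at hJ
  have hGhom : G.IsHomogeneous 2 := (isHomogeneous_of_mem_initialFormsOf y hF).map κ
  -- over the algebraic closure
  set L := AlgebraicClosure (ResidueField A) with hL
  haveI : CharP L 2 := charP_of_injective_algebraMap (algebraMap (ResidueField A) L).injective 2
  have hgeom' : dirDimOver A L = directrixDim (Ideal.span {MvPolynomial.map (algebraMap (ResidueField A) L) G}) := by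
    rw [dirDimOver_eq' A L hdA (σ ∘ y) hσy, hJ, map_span_singleton_mvPolynomial]
  have hgeomA : geomDirDim A = dirDimOver A L := rfl
  -- `Ḡ ≠ 0` (else `ē = d`)
  have hGL0 : MvPolynomial.map (algebraMap (ResidueField A) L) G ≠ 0 := by
    intro h0
    rw [h0, Ideal.span_singleton_zero, directrixDim_bot] at hgeom'
    omega
  -- `τ_{κ̄}(Ḡ) ≤ 1`
  have hτL : hironakaTau L ({MvPolynomial.map (algebraMap (ResidueField A) L) G} : Set (MvPolynomial (Fin d) L)) ≤ 1 := by
    rw [hironakaTau_eq_of_directrixDim_span_singleton (hGhom.map _) hGL0 hgeom'.symm]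
    omega
  -- cross coefficients vanish over `κ̄`, hence over `κ(R)`
  have hc := coeff_add_single_eq_zero_of_hironakaTau_le_one hτL hij
  rw [coeff_map, hG, coeff_map, map_eq_zero_iff _ (algebraMap (ResidueField A) L).injective,
    map_eq_zero_iff _ hκ.1] at hc
  exact hc

/-! ## §2. The cross coefficients of the E2 successor shape -/

section Shape

variable {κ : Type u} [Field κ] {d : ℕ}

/-- `∂ᵢ(Σ sₖYₖ) = sᵢ`. [folklore] -/
theorem pderiv_sum_C_mul_X (s : Fin d → κ) (i : Fin d) :
    pderiv i (∑ k, C (s k) * X k : MvPolynomial (Fin d) κ) = C (s i) := by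
  rw [map_sum, Finset.sum_eq_single i]
  · rw [pderiv_C_mul, pderiv_X, Pi.single_eq_same, mul_one]
  · intro k _ hk
    rw [pderiv_C_mul, pderiv_X, Pi.single_eq_of_ne hk, mul_zero]
  · intro hi; exact absurd (Finset.mem_univ i) hi

/-- `[Yⱼ](Σ sₖYₖ) = sⱼ`. [folklore] -/
theorem coeff_single_sum_C_mul_X (s : Fin d → κ) (j : Fin d) :
    coeff (Finsupp.single j 1) (∑ k, C (s k) * X k : MvPolynomial (Fin d) κ) = s j := by
  rw [coeff_sum, Finset.sum_eq_single j]
  · rw [coeff_C_mul, coeff_X, if_pos rfl, mul_one]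
  · intro k _ hk
    rw [coeff_C_mul, X, coeff_monomial, if_neg, mul_zero]
    exact fun h => hk (Finsupp.single_left_injective one_ne_zero h)
  · intro hj; exact absurd (Finset.mem_univ j) hj

/-- In characteristic two `∂ᵢ(p²) = 0`. [folklore] -/
theorem pderiv_sq_eq_zero [CharP κ 2] (p : MvPolynomial (Fin d) κ) (i : Fin d) : pderiv i (p ^ 2) = 0 := by
  rw [Derivation.leibniz_pow, two_nsmul, CharTwo.add_self_eq_zero]

/-- **The cross coefficients of the E2 successor shape** `F = c·((Σ uₖYₖ)² + λ(Σ vₖYₖ)²) + (Σ tₖYₖ)·(Σ aₖYₖ)` in characteristic two: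
`[YᵢYⱼ]F = tᵢaⱼ + tⱼaᵢ` for `i ≠ j` (squares have vanishing partial derivatives). [folklore] -/
theorem coeff_cross_shape [CharP κ 2] (c lam : κ) (u v t a : Fin d → κ) {i j : Fin d} (hij : i ≠ j) :
    coeff (Finsupp.single i 1 + Finsupp.single j 1)
      (C c * ((∑ k, C (u k) * X k) ^ 2 + C lam * (∑ k, C (v k) * X k) ^ 2) +
        (∑ k, C (t k) * X k) * (∑ k, C (a k) * X k) : MvPolynomial (Fin d) κ) = t i * a j + t j * a i := by
  rw [← coeff_single_pderiv_of_ne _ hij, map_add, pderiv_C_mul, map_add, pderiv_C_mul, pderiv_sq_eq_zero, pderiv_sq_eq_zero,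
    mul_zero, add_zero, mul_zero, zero_add, pderiv_mul, pderiv_sum_C_mul_X, pderiv_sum_C_mul_X, coeff_add, coeff_C_mul,
    coeff_single_sum_C_mul_X, mul_comm (∑ k, C (t k) * X k : MvPolynomial (Fin d) κ) (C (a i)), coeff_C_mul, coeff_single_sum_C_mul_X]
  ring

/-- **Parallel vectors.** Over a field of characteristic two, if `tᵢaⱼ + tⱼaᵢ = 0` for all `i ≠ j` and `t_k ≠ 0` for some `k`, then
`a = γ·t` with `γ = a_k/t_k`. [folklore] -/
theorem exists_eq_mul_of_cross_eq_zero [CharP κ 2] (t a : Fin d → κ)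
    (hcross : ∀ i j : Fin d, i ≠ j → t i * a j + t j * a i = 0) {k : Fin d} (hk : t k ≠ 0) :
    ∃ γ : κ, ∀ j, a j = γ * t j := by
  refine ⟨a k / t k, fun j => ?_⟩
  by_cases hjk : j = k
  · subst hjk
    rw [div_mul_cancel₀ _ hk]
  · have h := hcross k j (Ne.symm hjk)
    have h' : t k * a j = t j * a k := by
      have := eq_neg_of_add_eq_zero_left h
      rwa [CharTwo.neg_eq] at this
    field_simp
    linear_combination h'

end Shape

/-! ## §3. (N3b): `ē = emb.dim − 1` at the next point forces `G ≡ γ·t (mod 𝔪²)` -/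

/-- **(N3b) AT RING LEVEL.** `R` regular local with regular parameters `y : Fin d → R`, `σ : R ↠ A` with `ker σ = (h)`, `h ∈ 𝔪² ∖ 𝔪³`,
residue characteristic two, and `h = ĉ·(u² + λ̂·v²) + t·G` with `u, v, G ∈ 𝔪` and `t ∈ 𝔪 ∖ 𝔪²`. If `ē(A) = d − 1` (the directrix of the
tangent cone is a single line over `κ̄`: the initial form is a square) then **`G ∈ (t) + 𝔪²`** — the cross terms `YᵢYⱼ` of the initial form
`c̄·((Σūₖ Yₖ)² + λ̄(Σv̄ₖYₖ)²) + (Σt̄ₖYₖ)(Σāₖ Yₖ)` are `t̄ᵢāⱼ + t̄ⱼāᵢ`, they all vanish, `t̄ ≠ 0`, so `ā ∥ t̄`. No hypothesis on `ĉ, λ̂`.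
[OURS · L1 W4.2 · k2 · E2 chart calculus, brick 13] [folklore] -/
theorem mem_span_sup_sq_of_geomDirDim {R A : Type u} [CommRing R] [IsRegularLocalRing R] [CommRing A] [IsLocalRing A]
    [IsNoetherianRing A] [CharP (ResidueField A) 2] {d : ℕ} (hd : (maximalIdeal R).spanFinrank = d) (y : Fin d → R)
    (hy : Ideal.span (Set.range y) = maximalIdeal R) (σ : R →+* A) (hσ : Function.Surjective σ) {h : R}
    (hker : RingHom.ker σ = Ideal.span {h}) (h2 : h ∈ maximalIdeal R ^ 2) (h3 : h ∉ maximalIdeal R ^ (2 + 1))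
    (hgeom : geomDirDim A + 1 = d) {cc lam u v t G : R} (hu : u ∈ maximalIdeal R) (hv : v ∈ maximalIdeal R)
    (ht : t ∈ maximalIdeal R) (ht2 : t ∉ maximalIdeal R ^ 2) (hG : G ∈ maximalIdeal R)
    (hshape : h = cc * (u ^ 2 + lam * v ^ 2) + t * G) : G ∈ Ideal.span {t} ⊔ maximalIdeal R ^ 2 := by
  -- residue characteristic two in `R`
  haveI := IsLocalHom.of_surjective σ hσ
  haveI : CharP (ResidueField R) 2 := ((ResidueField.map σ).charP_iff_charP 2).mpr inferInstance
  -- coordinates of `u, v, t, G` in the regular parameters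
  rw [← hy] at hu hv ht hG
  obtain ⟨uu, huu⟩ := Ideal.mem_span_range_iff_exists_fun.mp hu
  obtain ⟨vv, hvv⟩ := Ideal.mem_span_range_iff_exists_fun.mp hv
  obtain ⟨tt, htt⟩ := Ideal.mem_span_range_iff_exists_fun.mp ht
  obtain ⟨aa, haa⟩ := Ideal.mem_span_range_iff_exists_fun.mp hG
  -- the degree-two form presenting `h`
  set Φ : MvPolynomial (Fin d) R := C cc * ((∑ k, C (uu k) * X k) ^ 2 + C lam * (∑ k, C (vv k) * X k) ^ 2) +
    (∑ k, C (tt k) * X k) * (∑ k, C (aa k) * X k) with hΦ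
  have hℓ : ∀ s : Fin d → R, (∑ k, C (s k) * X k : MvPolynomial (Fin d) R).IsHomogeneous 1 := fun s =>
    IsHomogeneous.sum _ _ _ fun k _ => by simpa using (isHomogeneous_C (Fin d) (s k)).mul (isHomogeneous_X R k)
  have hΦhom : Φ.IsHomogeneous 2 := by
    have h1 : ((∑ k, C (uu k) * X k : MvPolynomial (Fin d) R) ^ 2).IsHomogeneous 2 := by simpa using (hℓ uu).pow 2
    have h2' : (C lam * (∑ k, C (vv k) * X k) ^ 2 : MvPolynomial (Fin d) R).IsHomogeneous 2 := by
      simpa using (isHomogeneous_C (Fin d) lam).mul ((hℓ vv).pow 2)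
    have h3' : (C cc * ((∑ k, C (uu k) * X k) ^ 2 + C lam * (∑ k, C (vv k) * X k) ^ 2) : MvPolynomial (Fin d) R).IsHomogeneous 2 := by
      simpa using (isHomogeneous_C (Fin d) cc).mul (h1.add h2')
    have h4' : ((∑ k, C (tt k) * X k) * (∑ k, C (aa k) * X k) : MvPolynomial (Fin d) R).IsHomogeneous 2 := by
      simpa using (hℓ tt).mul (hℓ aa)
    exact h3'.add h4'
  have hℓeval : ∀ s : Fin d → R, MvPolynomial.eval y (∑ k, C (s k) * X k) = ∑ k, s k * y k := fun s => by
    rw [map_sum]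
    exact Finset.sum_congr rfl fun k _ => by rw [map_mul, eval_C, eval_X]
  have hΦeval : MvPolynomial.eval y Φ = h := by
    rw [hΦ, map_add, map_mul, map_mul, map_add, map_mul, map_pow, map_pow, eval_C, eval_C, hℓeval, hℓeval, hℓeval, hℓeval,
      huu, hvv, htt, haa, hshape]
  have hF : MvPolynomial.map (residue R) Φ ∈ initialFormsOf y h 2 := ⟨Φ, hΦhom, hΦeval, rfl⟩
  have hℓmap : ∀ s : Fin d → R, MvPolynomial.map (residue R) (∑ k, C (s k) * X k) =
      ∑ k, C (residue R (s k)) * (X k : MvPolynomial (Fin d) (ResidueField R)) := fun s => by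
    rw [map_sum]
    exact Finset.sum_congr rfl fun k _ => by rw [map_mul, map_C, map_X]
  have hFshape : MvPolynomial.map (residue R) Φ =
      C (residue R cc) * ((∑ k, C (residue R (uu k)) * X k) ^ 2 + C (residue R lam) * (∑ k, C (residue R (vv k)) * X k) ^ 2) +
        (∑ k, C (residue R (tt k)) * X k) * (∑ k, C (residue R (aa k)) * X k) := by
    rw [hΦ, map_add, map_mul, map_mul, map_add, map_mul, map_pow, map_pow, map_C, map_C, hℓmap, hℓmap, hℓmap, hℓmap]
  -- all cross coefficients vanish: `t̄ᵢāⱼ + t̄ⱼāᵢ = 0`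
  have hcross : ∀ i j : Fin d, i ≠ j → residue R (tt i) * residue R (aa j) + residue R (tt j) * residue R (aa i) = 0 := by
    intro i j hij
    have h0 := coeff_cross_eq_zero_of_geomDirDim hd y hy σ hσ hker h2 h3 hF hgeom hij
    rwa [hFshape, coeff_cross_shape (hij := hij)] at h0
  -- `t̄ ≠ 0` since `t ∉ 𝔪²`
  have htk : ∃ k, residue R (tt k) ≠ 0 := by
    by_contra hall
    simp only [not_exists, not_not] at hall
    apply ht2
    rw [← htt, pow_two]
    refine Ideal.sum_mem _ fun k _ => Ideal.mul_mem_mul ((residue_eq_zero_iff _).mp (hall k)) ?_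
    rw [← hy]; exact Ideal.subset_span (Set.mem_range_self k)
  obtain ⟨k, hk⟩ := htk
  obtain ⟨γbar, hγ⟩ := exists_eq_mul_of_cross_eq_zero (fun k => residue R (tt k)) (fun k => residue R (aa k)) hcross hk
  obtain ⟨γ, rfl⟩ := Ideal.Quotient.mk_surjective (I := maximalIdeal R) γbar
  -- `aⱼ − γ tⱼ ∈ 𝔪` for all `j`
  have hdiff : ∀ j, aa j - γ * tt j ∈ maximalIdeal R := fun j => by
    rw [← residue_eq_zero_iff, map_sub, map_mul]
    exact sub_eq_zero.mpr (hγ j)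
  -- `G − γ t ∈ 𝔪²`
  have hGγ : G - γ * t ∈ maximalIdeal R ^ 2 := by
    have : G - γ * t = ∑ j, (aa j - γ * tt j) * y j := by
      rw [← haa, ← htt, Finset.mul_sum, ← Finset.sum_sub_distrib]
      exact Finset.sum_congr rfl fun j _ => by ring
    rw [this, pow_two]
    refine Ideal.sum_mem _ fun j _ => Ideal.mul_mem_mul (hdiff j) ?_
    rw [← hy]; exact Ideal.subset_span (Set.mem_range_self j)
  -- conclusion
  rw [show G = γ * t + (G - γ * t) by ring]
  exact Submodule.add_mem_sup (Ideal.mul_mem_left _ γ (Ideal.mem_span_singleton_self t)) hGγ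

end Summit.ResolutionOfSingularities.ResolutionOfSingularities.Cruxes.SigmaMaxModifications.IdeasL1C6.E2Chart

end
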